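import Literature.Geometry.Kaehler.HolomorphicLineBundleCech
import Literature.Geometry.Kaehler.HolomorphicFunctionsDolbeault
import Literature.Geometry.Kaehler.LocalDDbarLemma
import Mathlib.Geometry.Manifold.PartitionOfUnity
import Mathlib.Geometry.Manifold.Algebra.Monoid
import HarnessLib

/-!
# The smooth contraction of a holomorphic `1`-cocycle of `𝒪(L)` and its `∂̄` (Leray, degree one — I)

Layer `Literature/Geometry/Kaehler`. First half of the degree-one Leray/smoothing lemma for the
sheaf `𝒪(L)` of sections of a cocycle line bundle (O. Forster, *Lectures on Riemann Surfaces*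
(1981), §12.6 and Lemma 14.7; H. Grauert, R. Remmert, *Theorie der Steinschen Räume* (1977),
Kap. VI §4.3; Voisin I, proof of Thm. 4.41 in degree `1`), on a framed cover `𝔙 = (V_k, frame k)`
(`HolomorphicLineBundleCech`) with a smooth partition of unity `(ρ_k)` subordinate to `(V_k)`:

* `FramedCover.contract C ρ z l = Σ_k ρ_k · g_{frame k, frame l} · z_{(k,l)}` — the smooth section
  `b_l` of `L` over `V_l` (in the frame `σ_{frame l}`) contracting the holomorphic `1`-cochain `z`
  (Bott–Tu's `(K z)_l = Σ_k ρ_k z_{(k,l)}`, with the change of frame); it is real-`C^∞` at the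
  points of `V_l` (`contMDiffAt_contract`), and for a COCYCLE `z` its twisted Čech coboundary is `z`:
  **`g_{frame l, frame k} b_l - b_k = z_{(k,l)}` on `V_k ∩ V_l`** (`coordChange_mul_contract_sub`);
* `FramedCover.contractForm` — `b_l` as a `(0,0)`-form on `V_l` (`pqFormsOn`), and
  `FramedCover.dbarContract C ρ z l = ∂̄ b_l ∈ A^{0,1}(V_l)`, a `∂̄`-closed `(0,1)`-form on `V_l`
  (`localDbar_dbarContract`);
* **`FramedCover.coordChange_smul_dbarContract`** — the `∂̄ b_l` GLUE to an `L`-valued form: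
  `g_{frame l, frame k}(x) (∂̄ b_l)_x = (∂̄ b_k)_x` on `V_k ∩ V_l` (from the coboundary identity,
  `∂̄(g f) = g ∂̄f` for holomorphic `g` and `∂̄ z_{(k,l)} = 0`).

Auxiliary: `contMDiffAt_mul_of_tsupport_subset` (a smooth cut-off times a function smooth on an open
set containing its support), `dolbeaultBar_ofFun_mul_sub_apply` (`∂̄(g f₁ - f₀) = g ∂̄f₁ - ∂̄f₀` at a
point), `FramedCover.delta_one_eq_zero_apply` (the cocycle condition of a `1`-cochain at a point).
Everything is proved; the definitions are `contract`, `contractForm`, `dbarContract`.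

## References

* O. Forster, *Lectures on Riemann Surfaces*, GTM 81 (1981), §12.6, Lemma 14.7. [Forster1981]
* H. Grauert, R. Remmert, *Theorie der Steinschen Räume* (1977), Kap. VI §4.3. [GrauertRemmert1977]
* R. Bott, L. W. Tu, *Differential Forms in Algebraic Topology* (1982), Prop. 8.5. [BottTu1982Forms]
-/

noncomputable section

open scoped Manifold ContDiff Topology
open Set Filter Function Literature.NumberTheory.Transcendental

namespace Literature.Geometry.Kaehler

variable {ι κ : Type*} {E : Type*} [NormedAddCommGroup E] [NormedSpace ℂ E]
  {M : Type*} [TopologicalSpace M] [ChartedSpace E M]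

/-! ### Auxiliary smoothness and `∂̄` lemmas -/

/-- **A smooth real cut-off times a complex function smooth on an open set containing the support of
the cut-off is smooth** at every point of a second open set `W`: `ρ • f` is `C^∞` at `x ∈ W` when
`tsupport ρ ⊆ V` and `f` is `C^∞` on `V ∩ W` (off the support the product vanishes near the point).
[folklore] -/
theorem contMDiffAt_mul_of_tsupport_subset {ρ : M → ℝ} (hρ : ContMDiff 𝓘(ℝ, E) 𝓘(ℝ) ∞ ρ)
    {V W : Set M} (hV : IsOpen V) (hW : IsOpen W) (hsupp : tsupport ρ ⊆ V) {f : M → ℂ}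
    (hf : ContMDiffOn 𝓘(ℝ, E) 𝓘(ℝ, ℂ) ∞ f (V ∩ W)) {x : M} (hx : x ∈ W) :
    ContMDiffAt 𝓘(ℝ, E) 𝓘(ℝ, ℂ) ∞ (fun y ↦ (ρ y : ℂ) * f y) x := by
  by_cases hxs : x ∈ tsupport ρ
  · have hfx : ContMDiffAt 𝓘(ℝ, E) 𝓘(ℝ, ℂ) ∞ f x :=
      (hf x ⟨hsupp hxs, hx⟩).contMDiffAt ((hV.inter hW).mem_nhds ⟨hsupp hxs, hx⟩)
    exact contMDiffAt_mul_complex' (Complex.ofRealCLM.contMDiff.comp hρ).contMDiffAt hfx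
  · have h0 : (fun y ↦ (ρ y : ℂ) * f y) =ᶠ[𝓝 x] fun _ ↦ 0 := by
      filter_upwards [notMem_tsupport_iff_eventuallyEq.1 hxs] with y hy
      simp only [hy, Pi.zero_apply, Complex.ofReal_zero, zero_mul]
    exact contMDiffAt_const.congr_of_eventuallyEq h0

/-- The cut-off to an open `W` of the `0`-form of a function `C^∞` at the points of `W` is a
`(0,0)`-form on `W`. [folklore] -/
theorem restr_ofFun_mem_pqFormsOn {W : Set M} (hW : IsOpen W) {f : M → ℂ}
    (hf : ∀ y ∈ W, ContMDiffAt 𝓘(ℝ, E) 𝓘(ℝ, ℂ) ∞ f y) :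
    (MForm.ofFun 𝓘(ℝ, E) f).restr W ∈ pqFormsOn E M W 0 0 :=
  ⟨fun y hy ↦ (MForm.smoothAt_ofFun_of_contMDiffAt (hf y hy)).congr_of_eventuallyEq (by
      filter_upwards [hW.mem_nhds hy] with y' hy'
      exact (MForm.restr_apply_of_mem _ hy').symm),
    fun y hy ↦ MForm.restr_apply_of_notMem _ hy, (isOfType_zero_zero _).restr _⟩

/-- `∂̄` at a point of an open `W` does not see the cut-off to `W` (locality of `∂̄`). [folklore] -/
theorem dolbeaultBar_restr_apply_of_mem {k : ℕ} {W : Set M} (hW : IsOpen W) (α : MForm 𝓘(ℝ, E) M ℂ k)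
    {x : M} (hx : x ∈ W) : dolbeaultBar (α.restr W) x = dolbeaultBar α x :=
  dolbeaultBar_congr_of_eventuallyEq (by
    filter_upwards [hW.mem_nhds hx] with y hy
    exact MForm.restr_apply_of_mem _ hy)

section DbarLinear

variable [FiniteDimensional ℂ E] [T2Space M] [IsManifold 𝓘(ℂ, E) ω M] [IsManifold 𝓘(ℝ, E) ∞ M]

/-- **`∂̄(g f₁ - f₀) = g ∂̄f₁ - ∂̄f₀` at a point of an open set** on which `g` is holomorphic and at
whose points `f₁, f₀` are `C^∞` (the Leibniz rule with a holomorphic factor and the additivity of `∂̄`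
at a point of common smoothness). [cite: VoisinHodgeI2002, §2.3.3 Lemma 2.29] -/
theorem dolbeaultBar_ofFun_mul_sub_apply {W : Set M} (hW : IsOpen W) {g f₁ f₀ : M → ℂ}
    (hg : MDifferentiableOn 𝓘(ℂ, E) 𝓘(ℂ, ℂ) g W) (hf₁ : ∀ y ∈ W, ContMDiffAt 𝓘(ℝ, E) 𝓘(ℝ, ℂ) ∞ f₁ y)
    (hf₀ : ∀ y ∈ W, ContMDiffAt 𝓘(ℝ, E) 𝓘(ℝ, ℂ) ∞ f₀ y) {x : M} (hx : x ∈ W) :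
    dolbeaultBar (MForm.ofFun 𝓘(ℝ, E) fun y ↦ g y * f₁ y - f₀ y) x =
      g x • dolbeaultBar (MForm.ofFun 𝓘(ℝ, E) f₁) x - dolbeaultBar (MForm.ofFun 𝓘(ℝ, E) f₀) x := by
  have hgc : ∀ y ∈ W, ContMDiffAt 𝓘(ℝ, E) 𝓘(ℝ, ℂ) ∞ g y := fun y hy ↦
    (contMDiffOn_real_of_mdifferentiableOn_complex hg hW).contMDiffAt (hW.mem_nhds hy)
  have hQ : (MForm.ofFun 𝓘(ℝ, E) fun y ↦ g y * f₁ y - f₀ y).restr W ∈ pqFormsOn E M W 0 0 :=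
    restr_ofFun_mem_pqFormsOn hW fun y hy ↦ (contMDiffAt_mul_complex' (hgc y hy) (hf₁ y hy)).sub (hf₀ y hy)
  have hR : (MForm.ofFun 𝓘(ℝ, E) f₀).restr W ∈ pqFormsOn E M W 0 0 := restr_ofFun_mem_pqFormsOn hW hf₀
  have hsum : (MForm.ofFun 𝓘(ℝ, E) fun y ↦ g y * f₁ y).restr W =
      (MForm.ofFun 𝓘(ℝ, E) fun y ↦ g y * f₁ y - f₀ y).restr W + (MForm.ofFun 𝓘(ℝ, E) f₀).restr W := by
    funext y
    by_cases hy : y ∈ W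
    · rw [Pi.add_apply, MForm.restr_apply_of_mem _ hy, MForm.restr_apply_of_mem _ hy,
        MForm.restr_apply_of_mem _ hy]
      ext v
      simp only [MForm.ofFun_apply, ContinuousAlternatingMap.add_apply, sub_add_cancel]
    · rw [Pi.add_apply, MForm.restr_apply_of_notMem _ hy, MForm.restr_apply_of_notMem _ hy,
        MForm.restr_apply_of_notMem _ hy, add_zero]
  have h := dolbeaultBar_add_apply_of_mem hW hQ hR hx
  rw [← hsum, dolbeaultBar_restr_apply_of_mem hW _ hx, dolbeaultBar_restr_apply_of_mem hW _ hx,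
    dolbeaultBar_restr_apply_of_mem hW _ hx, dolbeaultBar_ofFun_mul_of_mdifferentiableOn hW hg hx (hf₁ x hx)] at h
  rw [h, add_sub_cancel_right]

end DbarLinear

namespace HolomorphicLineBundle

namespace FramedCover

variable {L : HolomorphicLineBundle ι E M} (C : L.FramedCover κ)

/-! ### The cocycle condition of a `1`-cochain at a point -/

/-- **The cocycle condition of a `1`-cochain of `𝒪(L)` at a point** of `V_m ∩ V_k ∩ V_l`:
`g_{frame k, frame m} z_{(k,l)} - z_{(m,l)} + z_{(m,k)} = 0`. [cite: SerreFAC1955, n° 18] -/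
theorem delta_one_eq_zero_apply {z : C.Cochain 1} (hz : C.delta 1 z = 0) (m k l : κ) {x : M}
    (hx : x ∈ C.U m ∩ C.U k ∩ C.U l) :
    L.coordChange (C.frame k) (C.frame m) x * (z ![k, l] : M → ℂ) x - (z ![m, l] : M → ℂ) x +
      (z ![m, k] : M → ℂ) x = 0 := by
  have hxJ : x ∈ cechSet C.U ![m, k, l] := by
    rw [mem_cechSet_iff, Fin.forall_fin_succ, Fin.forall_fin_two]
    exact ⟨hx.1.1, hx.1.2, hx.2⟩
  have e0 : (![m, k, l] : Fin 3 → κ) ∘ Fin.succAbove 0 = ![k, l] := by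
    funext i; fin_cases i <;> rfl
  have e1 : (![m, k, l] : Fin 3 → κ) ∘ Fin.succAbove 1 = ![m, l] := by
    funext i; fin_cases i <;> rfl
  have e2 : (![m, k, l] : Fin 3 → κ) ∘ Fin.succAbove 2 = ![m, k] := by
    funext i; fin_cases i <;> rfl
  have h0 : (z ((![m, k, l] : Fin 3 → κ) ∘ Fin.succAbove 0) : M → ℂ) x = (z ![k, l] : M → ℂ) x := by
    rw [e0]
  have h1 : (z ((![m, k, l] : Fin 3 → κ) ∘ Fin.succAbove 1) : M → ℂ) x = (z ![m, l] : M → ℂ) x := by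
    rw [e1]
  have h2 : (z ((![m, k, l] : Fin 3 → κ) ∘ Fin.succAbove 2) : M → ℂ) x = (z ![m, k] : M → ℂ) x := by
    rw [e2]
  have ht0 : C.trans ![m, k, l] (Fin.succAbove (0 : Fin 3)) x =
      L.coordChange (C.frame k) (C.frame m) x := by
    unfold trans
    simp
  have ht1 : C.trans ![m, k, l] (Fin.succAbove (1 : Fin 3)) x = 1 :=
    C.trans_eq_one _ (Fin.succAbove_ne_zero_zero one_ne_zero) hxJ
  have ht2 : C.trans ![m, k, l] (Fin.succAbove (2 : Fin 3)) x = 1 :=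
    C.trans_eq_one _ (Fin.succAbove_ne_zero_zero (by decide)) hxJ
  have h := congr_fun (congr_arg Subtype.val (congr_fun hz ![m, k, l])) x
  rw [C.delta_apply_apply_of_mem z hxJ, Fin.sum_univ_three] at h
  simp only [Fin.val_zero, pow_zero, one_mul, Fin.val_one, pow_one, Fin.val_two, h0, h1, h2, ht0, ht1,
    ht2, Pi.zero_apply, ZeroMemClass.coe_zero] at h
  linear_combination h

/-- The symmetric form of the degree-`0`-type gluing hidden in a `1`-cocycle: `z_{(k,k)} = 0` on `V_k`.
[cite: SerreFAC1955, n° 18] -/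
theorem apply_diag_eq_zero_of_delta_one_eq_zero {z : C.Cochain 1} (hz : C.delta 1 z = 0) (k : κ) {x : M}
    (hx : x ∈ C.U k) : (z ![k, k] : M → ℂ) x = 0 := by
  have h := C.delta_one_eq_zero_apply hz k k k ⟨⟨hx, hx⟩, hx⟩
  rw [L.coordChange_self _ (C.subset k hx), one_mul, sub_self, zero_add] at h
  exact h

/-! ### The smooth contraction `b_l = Σ_k ρ_k g_{frame k, frame l} z_{(k,l)}` -/

section Contract

variable [Fintype κ] (ρ : SmoothPartitionOfUnity κ 𝓘(ℝ, E) M univ) (hρ : ρ.IsSubordinate C.U)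

/-- **The smooth contraction of a `1`-cochain**: `b_l = Σ_k ρ_k · g_{frame k, frame l} · z_{(k,l)}`,
the coordinate in the frame `σ_{frame l}` of a smooth section of `L` over `V_l` (Bott–Tu's
`(K z)_l = Σ_k ρ_k z_{(k,l)}` for the fine resolution, the component `z_{(k,l)}` — written in the
frame of its first index `k` — being converted to the frame of `l`). A function on `M`, used on `V_l`.
[cite: Forster1981, §12.6] -/
def contract (z : C.Cochain 1) (l : κ) : M → ℂ :=
  fun x ↦ ∑ k, (ρ k x : ℂ) * (L.coordChange (C.frame k) (C.frame l) x * (z ![k, l] : M → ℂ) x)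

/-- The contraction, unfolded. [folklore] -/
theorem contract_apply (z : C.Cochain 1) (l : κ) (x : M) :
    C.contract ρ z l x =
      ∑ k, (ρ k x : ℂ) * (L.coordChange (C.frame k) (C.frame l) x * (z ![k, l] : M → ℂ) x) :=
  rfl

include hρ in
/-- **The contraction is real-`C^∞` at the points of `V_l`** (each term is a smooth cut-off supported
in `V_k` times a function holomorphic on `V_k ∩ V_l`). [cite: Forster1981, §12.6] -/
theorem contMDiffAt_contract [FiniteDimensional ℂ E] [IsManifold 𝓘(ℂ, E) ω M] [IsManifold 𝓘(ℝ, E) ∞ M]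
    (z : C.Cochain 1) (l : κ)
    {x : M} (hx : x ∈ C.U l) : ContMDiffAt 𝓘(ℝ, E) 𝓘(ℝ, ℂ) ∞ (C.contract ρ z l) x := by
  refine contMDiffAt_finsetSum fun k _ ↦ ?_
  refine contMDiffAt_mul_of_tsupport_subset (ρ k).contMDiff (C.isOpen k) (C.isOpen l) (hρ k) ?_ hx
  have hhol : MDifferentiableOn 𝓘(ℂ, E) 𝓘(ℂ, ℂ)
      (fun y ↦ L.coordChange (C.frame k) (C.frame l) y * (z ![k, l] : M → ℂ) y) (C.U k ∩ C.U l) :=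
    ((L.mdifferentiableOn_coordChange _ _).mono fun y hy ↦ ⟨C.subset k hy.1, C.subset l hy.2⟩).mul
      ((holFunOn.mdifferentiableOn (z ![k, l])).mono fun y hy ↦ by
        rw [mem_cechSet_iff, Fin.forall_fin_two]; exact hy)
  exact contMDiffOn_real_of_mdifferentiableOn_complex hhol ((C.isOpen k).inter (C.isOpen l))

include hρ in
/-- **The twisted Čech coboundary of the contraction of a cocycle is the cocycle**:
`g_{frame l, frame k} b_l - b_k = z_{(k,l)}` on `V_k ∩ V_l` (the cocycle condition
`z_{(m,l)} - z_{(m,k)} = g_{frame k, frame m} z_{(k,l)}`, `g_{ml} g_{km}… = …` and `Σ_m ρ_m = 1`).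
[cite: Forster1981, §12.6] -/
theorem coordChange_mul_contract_sub {z : C.Cochain 1} (hz : C.delta 1 z = 0) (k l : κ) {x : M}
    (hx : x ∈ C.U k ∩ C.U l) :
    L.coordChange (C.frame l) (C.frame k) x * C.contract ρ z l x - C.contract ρ z k x =
      (z ![k, l] : M → ℂ) x := by
  have hk := C.subset k hx.1
  have hl := C.subset l hx.2
  rw [contract_apply, contract_apply, Finset.mul_sum, ← Finset.sum_sub_distrib]
  have hterm : ∀ m, L.coordChange (C.frame l) (C.frame k) x *
      ((ρ m x : ℂ) * (L.coordChange (C.frame m) (C.frame l) x * (z ![m, l] : M → ℂ) x)) -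
        (ρ m x : ℂ) * (L.coordChange (C.frame m) (C.frame k) x * (z ![m, k] : M → ℂ) x) =
      (ρ m x : ℂ) * (z ![k, l] : M → ℂ) x := by
    intro m
    by_cases hxm : x ∈ C.U m
    · have hm := C.subset m hxm
      have hcoc := C.delta_one_eq_zero_apply hz m k l ⟨⟨hxm, hx.1⟩, hx.2⟩
      have hg₁ : L.coordChange (C.frame l) (C.frame k) x * L.coordChange (C.frame m) (C.frame l) x =
          L.coordChange (C.frame m) (C.frame k) x := by
        rw [mul_comm]
        exact L.coordChange_comp _ _ _ x ⟨⟨hm, hl⟩, hk⟩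
      have hg₂ : L.coordChange (C.frame m) (C.frame k) x * L.coordChange (C.frame k) (C.frame m) x = 1 :=
        L.coordChange_mul_symm _ _ hm hk
      have hzml : (z ![m, l] : M → ℂ) x =
          (z ![m, k] : M → ℂ) x + L.coordChange (C.frame k) (C.frame m) x * (z ![k, l] : M → ℂ) x := by
        linear_combination (-1 : ℂ) * hcoc
      rw [hzml]
      linear_combination ((ρ m x : ℂ) * (z ![m, k] : M → ℂ) x +
          (ρ m x : ℂ) * (z ![k, l] : M → ℂ) x * L.coordChange (C.frame k) (C.frame m) x) * hg₁ +
        ((ρ m x : ℂ) * (z ![k, l] : M → ℂ) x) * hg₂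
    · rw [rho_apply_eq_zero ρ hρ hxm, Complex.ofReal_zero, zero_mul, zero_mul, zero_mul, mul_zero,
        sub_zero]
  rw [Finset.sum_congr rfl fun m _ ↦ hterm m, ← Finset.sum_mul, ← Complex.ofReal_sum, sum_rho_apply,
    Complex.ofReal_one, one_mul]

/-! ### The contraction as a `(0,0)`-form on `V_l` and its `∂̄` -/

variable [FiniteDimensional ℂ E] [T2Space M] [IsManifold 𝓘(ℂ, E) ω M] [IsManifold 𝓘(ℝ, E) ∞ M]

omit [T2Space M] in
include hρ in
/-- The `0`-form of the contraction, cut off to `V_l`, is a `(0,0)`-form on `V_l`. [folklore] -/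
theorem restr_ofFun_contract_mem (z : C.Cochain 1) (l : κ) :
    (MForm.ofFun 𝓘(ℝ, E) (C.contract ρ z l)).restr (C.U l) ∈ pqFormsOn E M (C.U l) 0 0 :=
  restr_ofFun_mem_pqFormsOn (C.isOpen l) fun _ hy ↦ C.contMDiffAt_contract ρ hρ z l hy

/-- **The contraction `b_l` as a `(0,0)`-form on `V_l`.** [cite: Forster1981, §12.6] -/
def contractForm (z : C.Cochain 1) (l : κ) : ↥(pqFormsOn E M (C.U l) 0 0) :=
  ⟨(MForm.ofFun 𝓘(ℝ, E) (C.contract ρ z l)).restr (C.U l), C.restr_ofFun_contract_mem ρ hρ z l⟩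

omit [T2Space M] in
/-- The underlying form of `contractForm` (definitional). [folklore] -/
theorem coe_contractForm (z : C.Cochain 1) (l : κ) :
    (C.contractForm ρ hρ z l : MForm 𝓘(ℝ, E) M ℂ (0 + 0)) =
      (MForm.ofFun 𝓘(ℝ, E) (C.contract ρ z l)).restr (C.U l) :=
  rfl

/-- **`∂̄ b_l ∈ A^{0,1}(V_l)`**, the `(0,1)`-form on `V_l` obtained from the contraction.
[cite: Forster1981, Lemma 14.7] -/
def dbarContract (z : C.Cochain 1) (l : κ) : ↥(pqFormsOn E M (C.U l) 0 1) :=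
  localDbar E M (C.isOpen l) 0 0 (C.contractForm ρ hρ z l)

/-- `∂̄ b_l` is `∂̄`-closed on `V_l`. [cite: VoisinHodgeI2002, §2.3.3] -/
theorem localDbar_dbarContract (z : C.Cochain 1) (l : κ) :
    localDbar E M (C.isOpen l) 0 1 (C.dbarContract ρ hρ z l) = 0 :=
  localDbar_localDbar (C.isOpen l) _

/-- **`∂̄ b_l` at a point of `V_l` is `∂̄` of the `0`-form of the contraction** (locality of `∂̄`).
[folklore] -/
theorem dbarContract_apply_of_mem (z : C.Cochain 1) (l : κ) {x : M} (hx : x ∈ C.U l) :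
    (C.dbarContract ρ hρ z l : MForm 𝓘(ℝ, E) M ℂ (0 + (0 + 1))) x =
      dolbeaultBar (MForm.ofFun 𝓘(ℝ, E) (C.contract ρ z l)) x := by
  rw [dbarContract, localDbar_apply_of_mem _ _ hx, coe_contractForm,
    dolbeaultBar_restr_apply_of_mem (C.isOpen l) _ hx]

omit [FiniteDimensional ℂ E] [T2Space M] [IsManifold 𝓘(ℂ, E) ω M] in
include hρ in
/-- **`∂̄` of the `0`-form `x ↦ g(x) b_l(x) - b_k(x)` at a point of `V_k ∩ V_l` vanishes**: it is the
holomorphic function `z_{(k,l)}` there. [cite: Forster1981, Lemma 14.7] -/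
theorem dolbeaultBar_ofFun_coordChange_mul_contract_sub {z : C.Cochain 1} (hz : C.delta 1 z = 0) (k l : κ)
    {x : M} (hx : x ∈ C.U k ∩ C.U l) :
    dolbeaultBar (MForm.ofFun 𝓘(ℝ, E) fun y ↦
      L.coordChange (C.frame l) (C.frame k) y * C.contract ρ z l y - C.contract ρ z k y) x = 0 := by
  have hW : IsOpen (C.U k ∩ C.U l) := (C.isOpen k).inter (C.isOpen l)
  have hzW : MDifferentiableOn 𝓘(ℂ, E) 𝓘(ℂ, ℂ) (z ![k, l] : M → ℂ) (C.U k ∩ C.U l) :=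
    (holFunOn.mdifferentiableOn (z ![k, l])).mono fun y hy ↦ by
      rw [mem_cechSet_iff, Fin.forall_fin_two]; exact hy
  rw [← dolbeaultBar_ofFun_eq_zero_of_mdifferentiableOn hW hzW hx]
  refine dolbeaultBar_congr_of_eventuallyEq ?_
  filter_upwards [hW.mem_nhds hx] with y hy
  ext v
  simp only [MForm.ofFun_apply, C.coordChange_mul_contract_sub ρ hρ hz k l hy]

/-- **The `∂̄ b_l` glue to an `L`-valued `(0,1)`-form**: `g_{frame l, frame k}(x) (∂̄ b_l)_x = (∂̄ b_k)_x`
at every `x ∈ V_k ∩ V_l`, for a cocycle `z` (from `g b_l - b_k = z_{(k,l)}`, the Leibniz rule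
`∂̄(g f) = g ∂̄ f` for the holomorphic `g`, additivity of `∂̄` at a point of common smoothness, and
`∂̄ z_{(k,l)} = 0`). [cite: Forster1981, Lemma 14.7] -/
theorem coordChange_smul_dbarContract {z : C.Cochain 1} (hz : C.delta 1 z = 0) (k l : κ) {x : M}
    (hx : x ∈ C.U k ∩ C.U l) :
    L.coordChange (C.frame l) (C.frame k) x •
        (C.dbarContract ρ hρ z l : MForm 𝓘(ℝ, E) M ℂ (0 + (0 + 1))) x =
      (C.dbarContract ρ hρ z k : MForm 𝓘(ℝ, E) M ℂ (0 + (0 + 1))) x := by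
  have hW : IsOpen (C.U k ∩ C.U l) := (C.isOpen k).inter (C.isOpen l)
  have hg : MDifferentiableOn 𝓘(ℂ, E) 𝓘(ℂ, ℂ) (L.coordChange (C.frame l) (C.frame k)) (C.U k ∩ C.U l) :=
    (L.mdifferentiableOn_coordChange _ _).mono fun y hy ↦ ⟨C.subset l hy.2, C.subset k hy.1⟩
  have h := dolbeaultBar_ofFun_mul_sub_apply hW hg (fun y hy ↦ C.contMDiffAt_contract ρ hρ z l hy.2)
    (fun y hy ↦ C.contMDiffAt_contract ρ hρ z k hy.1) hx
  rw [C.dolbeaultBar_ofFun_coordChange_mul_contract_sub ρ hρ hz k l hx] at h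
  rw [C.dbarContract_apply_of_mem ρ hρ z l hx.2, C.dbarContract_apply_of_mem ρ hρ z k hx.1]
  exact (sub_eq_zero.1 h.symm)

end Contract

end FramedCover

end HolomorphicLineBundle

end Literature.Geometry.Kaehler
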